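import Literature.Analysis.Convex.AlexandrovTheorem
import Mathlib.Analysis.Calculus.MeanValue
import Mathlib.Analysis.Calculus.ContDiff.Defs
import HarnessLib

/-!
# Alexandrov's theorem on open sets and for semi-convex functions (CDGH Prop. 2.1)

`Literature/Analysis/Convex/AlexandrovTheorem.lean` proves Alexandrov's theorem for a convex
function on the whole of a finite-dimensional real inner product space. This file localises it and
extends it to semi-convex functions, which is the form used by Chruściel–Delay–Galloway–Howard,
*Regularity of horizons and the area theorem* (2001), Prop. 2.1: "Let `B` be an open subset of
`ℝᵖ` and let `f : B → ℝ` be semi-convex. Then there exists a set `B_Al ⊂ B` such that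
`ℒᵖ(B ∖ B_Al) = 0`, `f` is differentiable at all points `x ∈ B_Al`, and twice differentiable there
in the sense that `f(y) - f(x) - df(x)(y - x) = Q(x - y, x - y) + o(|x - y|²)`" — where
(loc. cit., §2) `f` is *semi-convex* if each point has a convex neighbourhood `𝒰` and a `C²`
function `φ` on `𝒰` with `f + φ` convex on `𝒰`.

* `ae_mem_imp_of_forall_exists_mem_nhdsWithin` — a property holding a.e. near every point of a set
  holds a.e. on the set (second countability);
* `convexExtension f U x₀ r` — the supremum of the affine minorants `f z + ⟪q, · - z⟫` of `f` over
  subgradients `q ∈ ∂_U f(z)` at points `z ∈ closedBall x₀ r`: a finite convex function on the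
  whole space which agrees with `f` on `closedBall x₀ r` (for `f` convex on an open convex
  `U ⊇ closedBall x₀ R`, `r < R`) and whose subdifferential contains `∂_U f` there;
* `ConvexOn.ae_hasGradientAt_taylor_two_of_isOpen` — Alexandrov's theorem for a convex function on
  an open convex set `U`: for a.e. `y ∈ U`, gradient, differentiability of `∂_U f` at `y`, and the
  second-order expansion;
* `taylor_two_isLittleO_of_hasFDerivAt` — the second-order Taylor expansion of a function whose
  derivative is differentiable at a point;
* `SemiconvexOn` (definition, CDGH §2) and `SemiconvexOn.ae_hasGradientAt_taylor_two` —
  **CDGH Prop. 2.1**: a semi-convex function on an open set has, at a.e. point, a gradient and a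
  second-order expansion.

All results are proved; no named facts are introduced.

## References

* P. T. Chruściel, E. Delay, G. J. Galloway, R. Howard, *Regularity of horizons and the area
  theorem*, Ann. Henri Poincaré 2 (2001) 109–178 = arXiv:gr-qc/0001003, §2, Prop. 2.1 (held copy,
  chunk p0006). Key `ChruscielEtAl2001`.
* L. C. Evans, R. F. Gariepy, *Measure Theory and Fine Properties of Functions*, CRC 1992, Thm. 6.9
  (held copy PDF p. 154). Key `EvansGariepy1992`.
* W. H. Fleming, H. M. Soner, *Controlled Markov processes and viscosity solutions*, Springer 1993
  (the source cited by CDGH for Prop. 2.1).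
-/

noncomputable section

open Set Filter Metric Topology InnerProductSpace MeasureTheory Asymptotics
open scoped RealInnerProductSpace NNReal ENNReal

namespace Literature.Analysis.Convex

variable {E : Type*} [NormedAddCommGroup E] [InnerProductSpace ℝ E] [FiniteDimensional ℝ E]

/-! ### From local to global almost-everywhere statements -/

section AE

variable {X : Type*} [TopologicalSpace X] [SecondCountableTopology X] [MeasurableSpace X]
  {μ : Measure X}

/-- If every point `x` of a set `O` has a neighbourhood `V` within `O` such that `P` holds a.e. on
`V`, then `P` holds a.e. on `O` (second countability: countably many such `V` cover `O`,
`TopologicalSpace.countable_cover_nhdsWithin`). [folklore] -/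
theorem ae_mem_imp_of_forall_exists_mem_nhdsWithin {O : Set X} {P : X → Prop}
    (h : ∀ x ∈ O, ∃ V ∈ 𝓝[O] x, ∀ᵐ y ∂μ, y ∈ V → P y) : ∀ᵐ y ∂μ, y ∈ O → P y := by
  choose! V hV hP using h
  obtain ⟨t, htO, htc, hcover⟩ := TopologicalSpace.countable_cover_nhdsWithin hV
  have hall : ∀ᵐ y ∂μ, ∀ x ∈ t, y ∈ V x → P y := (ae_ball_iff htc).mpr fun x hx ↦ hP x (htO hx)
  filter_upwards [hall] with y hy hyO
  obtain ⟨x, hx⟩ := mem_iUnion.mp (hcover hyO)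
  obtain ⟨hxt, hyx⟩ := mem_iUnion.mp hx
  exact hy x hxt hyx

end AE

/-! ### The convex extension of a convex function from a ball -/

section Extension

variable {f : E → ℝ} {U : Set E} {x₀ : E} {r R : ℝ}

/-- The index set of the affine minorants used in `convexExtension`: pairs `(z, q)` with
`z ∈ closedBall x₀ r` and `q` a subgradient of `f` at `z` relative to `U` (Hiriart-Urruty–
Lemaréchal 2001, Chap. D, Def. 1.2.1: the subdifferential `∂f(z)`; the affine minorants
`y ↦ f z + ⟪q, y - z⟫` of Chap. B, Thm. 1.3.8).
[cite: HiriarturrutyLemarechal2001, Chap. D, Def. 1.2.1 (PDF p. 167)] -/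
def minorantIndex (f : E → ℝ) (U : Set E) (x₀ : E) (r : ℝ) : Set (E × E) :=
  {zq | zq.1 ∈ closedBall x₀ r ∧ HasSubgradientWithinAt f U zq.2 zq.1}

/-- The **convex extension** of `f` from the ball `closedBall x₀ r`: the pointwise supremum of the
affine minorants `y ↦ f z + ⟪q, y - z⟫`, `z ∈ closedBall x₀ r`, `q ∈ ∂_U f(z)` (a standard device:
a convex function is the upper envelope of its affine minorants, Hiriart-Urruty–Lemaréchal 2001,
Chap. B, Thm. 1.3.8 / Chap. D, Def. 1.2.1). For `f` convex on an open convex `U ⊇ closedBall x₀ R`,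
`r < R`, it is a finite convex function on the whole space equal to `f` on `closedBall x₀ r`.
[cite: HiriarturrutyLemarechal2001, Chap. D, Def. 1.2.1 (PDF p. 167)] -/
def convexExtension (f : E → ℝ) (U : Set E) (x₀ : E) (r : ℝ) (y : E) : ℝ :=
  sSup ((fun zq : E × E ↦ f zq.1 + ⟪zq.2, y - zq.1⟫) '' minorantIndex f U x₀ r)

omit [FiniteDimensional ℝ E] in
/-- Unfolding lemma for `minorantIndex`. [folklore] -/
@[simp] theorem mem_minorantIndex_iff {zq : E × E} :
    zq ∈ minorantIndex f U x₀ r ↔ zq.1 ∈ closedBall x₀ r ∧ HasSubgradientWithinAt f U zq.2 zq.1 :=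
  Iff.rfl

/-- **Uniform bounds for the minorants**: for `f` convex on an open `U ⊇ closedBall x₀ R` and
`0 ≤ r < R`, there are `M, K` with `|f z| ≤ M` and `‖q‖ ≤ K` for every `z ∈ closedBall x₀ r` and
every subgradient `q` of `f` at `z` relative to `U` (continuity on the compact ball; Lipschitz
continuity of convex functions on smaller balls, `ConvexOn.exists_lipschitzOnWith_of_isBounded`;
`HasSubgradientWithinAt.norm_le`). [folklore] -/
theorem exists_bound_minorantIndex (hU : IsOpen U) (hf : ConvexOn ℝ U f) (hrR : r < R)
    (hRU : closedBall x₀ R ⊆ U) :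
    ∃ M K : ℝ, 0 ≤ K ∧ ∀ zq ∈ minorantIndex f U x₀ r, |f zq.1| ≤ M ∧ ‖zq.2‖ ≤ K := by
  haveI : ProperSpace E := FiniteDimensional.proper ℝ E
  have hcont : ContinuousOn f U := hf.continuousOn hU
  -- `|f| ≤ M` on the compact ball `closedBall x₀ R`
  obtain ⟨M, hM⟩ : ∃ M, ∀ z ∈ closedBall x₀ R, |f z| ≤ M := by
    have hK : IsCompact (closedBall x₀ R) := isCompact_closedBall x₀ R
    obtain ⟨M, hM⟩ := hK.exists_bound_of_continuousOn (hcont.mono hRU)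
    exact ⟨M, fun z hz ↦ by simpa [Real.norm_eq_abs] using hM z hz⟩
  -- `f` is Lipschitz on `ball x₀ ((r + R) / 2)`
  have hballU : ball x₀ R ⊆ U := ball_subset_closedBall.trans hRU
  have hfball : ConvexOn ℝ (ball x₀ R) f := hf.subset hballU (convex_ball x₀ R)
  have hbdd : Bornology.IsBounded (f '' ball x₀ R) := by
    rw [isBounded_iff_bddBelow_bddAbove]
    constructor
    · refine ⟨-M, ?_⟩
      rintro _ ⟨z, hz, rfl⟩
      have := hM z (ball_subset_closedBall hz)
      linarith [neg_abs_le (f z)]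
    · refine ⟨M, ?_⟩
      rintro _ ⟨z, hz, rfl⟩
      exact (le_abs_self _).trans (hM z (ball_subset_closedBall hz))
  obtain ⟨K, hK⟩ := hfball.exists_lipschitzOnWith_of_isBounded (r' := (r + R) / 2) (by linarith) hbdd
  refine ⟨M, K, K.coe_nonneg, fun zq hzq ↦ ⟨hM zq.1 (closedBall_subset_closedBall hrR.le hzq.1), ?_⟩⟩
  -- the ball `ball z δ`, `δ = (R - r) / 2`, lies in the Lipschitz region and in `U`
  set δ : ℝ := (R - r) / 2 with hδ
  have hδ0 : 0 < δ := by rw [hδ]; linarith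
  have hz : zq.1 ∈ closedBall x₀ r := hzq.1
  have hsub : ball zq.1 δ ⊆ ball x₀ ((r + R) / 2) := by
    intro w hw
    rw [mem_ball] at hw ⊢
    rw [mem_closedBall] at hz
    calc dist w x₀ ≤ dist w zq.1 + dist zq.1 x₀ := dist_triangle _ _ _
      _ < δ + r := add_lt_add_of_lt_of_le hw hz
      _ = (r + R) / 2 := by rw [hδ]; ring
  have hsubU : ball zq.1 δ ⊆ U :=
    hsub.trans ((ball_subset_ball (by linarith)).trans hballU)
  refine hzq.2.norm_le hδ0 K.coe_nonneg hsubU fun w hw ↦ ?_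
  have h1 := hK.dist_le_mul w (hsub hw) zq.1 (hsub (mem_ball_self hδ0))
  rw [Real.dist_eq, dist_eq_norm] at h1
  exact (le_abs_self _).trans h1

/-- The index set of minorants is nonempty (a subgradient exists at the centre). [folklore] -/
theorem minorantIndex_nonempty (hU : IsOpen U) (hf : ConvexOn ℝ U f) (hr : 0 ≤ r) (hrR : r < R)
    (hRU : closedBall x₀ R ⊆ U) : (minorantIndex f U x₀ r).Nonempty := by
  have hx₀ : x₀ ∈ U := hRU (mem_closedBall_self (hr.trans hrR.le))
  obtain ⟨q, hq⟩ := ConvexOn.exists_hasSubgradientWithinAt_of_finiteDimensional hf hU hx₀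
  exact ⟨(x₀, q), mem_closedBall_self hr, hq⟩

/-- The values of the minorants at a point `y` are bounded above (by `M + K (‖y - x₀‖ + r)`).
[folklore] -/
theorem bddAbove_minorants (hU : IsOpen U) (hf : ConvexOn ℝ U f) (hrR : r < R)
    (hRU : closedBall x₀ R ⊆ U) (y : E) :
    BddAbove ((fun zq : E × E ↦ f zq.1 + ⟪zq.2, y - zq.1⟫) '' minorantIndex f U x₀ r) := by
  obtain ⟨M, K, hK0, hMK⟩ := exists_bound_minorantIndex hU hf hrR hRU
  refine ⟨M + K * (‖y - x₀‖ + r), ?_⟩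
  rintro _ ⟨zq, hzq, rfl⟩
  obtain ⟨h1, h2⟩ := hMK zq hzq
  have h3 : ⟪zq.2, y - zq.1⟫ ≤ K * (‖y - x₀‖ + r) := by
    have h4 : ‖y - zq.1‖ ≤ ‖y - x₀‖ + r := by
      have hz : dist zq.1 x₀ ≤ r := mem_closedBall.mp hzq.1
      rw [dist_eq_norm] at hz
      calc ‖y - zq.1‖ = ‖(y - x₀) + (x₀ - zq.1)‖ := by rw [sub_add_sub_cancel]
        _ ≤ ‖y - x₀‖ + ‖x₀ - zq.1‖ := norm_add_le _ _
        _ ≤ ‖y - x₀‖ + r := by rw [← norm_neg (x₀ - zq.1), neg_sub]; gcongr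
    calc ⟪zq.2, y - zq.1⟫ ≤ ‖zq.2‖ * ‖y - zq.1‖ := real_inner_le_norm _ _
      _ ≤ K * (‖y - x₀‖ + r) := by gcongr
  linarith [le_abs_self (f zq.1)]

/-- **The extension is below `f` on `U`** (each affine minorant is, by the subgradient inequality).
[folklore] -/
theorem convexExtension_le (hU : IsOpen U) (hf : ConvexOn ℝ U f) (hr : 0 ≤ r) (hrR : r < R)
    (hRU : closedBall x₀ R ⊆ U) {y : E} (hy : y ∈ U) : convexExtension f U x₀ r y ≤ f y := by
  refine csSup_le ((minorantIndex_nonempty hU hf hr hrR hRU).image _) ?_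
  rintro _ ⟨zq, hzq, rfl⟩
  exact hzq.2 y hy

/-- **The extension is above `f` on the ball** (take the minorant at the point itself). [folklore] -/
theorem le_convexExtension (hU : IsOpen U) (hf : ConvexOn ℝ U f) (hrR : r < R)
    (hRU : closedBall x₀ R ⊆ U) {y : E} (hy : y ∈ closedBall x₀ r) :
    f y ≤ convexExtension f U x₀ r y := by
  have hyU : y ∈ U := hRU (closedBall_subset_closedBall hrR.le hy)
  obtain ⟨q, hq⟩ := ConvexOn.exists_hasSubgradientWithinAt_of_finiteDimensional hf hU hyU
  refine le_csSup_of_le (bddAbove_minorants hU hf hrR hRU y) ⟨(y, q), ⟨hy, hq⟩, rfl⟩ ?_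
  simp

/-- The extension agrees with `f` on `closedBall x₀ r`. [folklore] -/
theorem convexExtension_eq (hU : IsOpen U) (hf : ConvexOn ℝ U f) (hr : 0 ≤ r) (hrR : r < R)
    (hRU : closedBall x₀ R ⊆ U) {y : E} (hy : y ∈ closedBall x₀ r) :
    convexExtension f U x₀ r y = f y :=
  le_antisymm (convexExtension_le hU hf hr hrR hRU (hRU (closedBall_subset_closedBall hrR.le hy)))
    (le_convexExtension hU hf hrR hRU hy)

/-- **The extension is convex on the whole space** (a supremum of affine functions). [folklore] -/
theorem convexOn_convexExtension (hU : IsOpen U) (hf : ConvexOn ℝ U f) (hr : 0 ≤ r) (hrR : r < R)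
    (hRU : closedBall x₀ R ⊆ U) : ConvexOn ℝ univ (convexExtension f U x₀ r) := by
  refine ⟨convex_univ, fun y₁ _ y₂ _ a b ha hb hab ↦ ?_⟩
  have hne := (minorantIndex_nonempty hU hf hr hrR hRU).image
    (fun zq : E × E ↦ f zq.1 + ⟪zq.2, (a • y₁ + b • y₂) - zq.1⟫)
  refine csSup_le hne ?_
  rintro _ ⟨zq, hzq, rfl⟩
  have h1 : f zq.1 + ⟪zq.2, y₁ - zq.1⟫ ≤ convexExtension f U x₀ r y₁ :=
    le_csSup (bddAbove_minorants hU hf hrR hRU y₁) ⟨zq, hzq, rfl⟩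
  have h2 : f zq.1 + ⟪zq.2, y₂ - zq.1⟫ ≤ convexExtension f U x₀ r y₂ :=
    le_csSup (bddAbove_minorants hU hf hrR hRU y₂) ⟨zq, hzq, rfl⟩
  have hdec : a • y₁ + b • y₂ - zq.1 = a • (y₁ - zq.1) + b • (y₂ - zq.1) := by
    have : zq.1 = a • zq.1 + b • zq.1 := by rw [← add_smul, hab, one_smul]
    conv_lhs => rw [this]
    simp only [smul_sub]; abel
  show f zq.1 + ⟪zq.2, a • y₁ + b • y₂ - zq.1⟫ ≤
    a • convexExtension f U x₀ r y₁ + b • convexExtension f U x₀ r y₂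
  rw [hdec, inner_add_right, real_inner_smul_right, real_inner_smul_right, smul_eq_mul, smul_eq_mul]
  have hf1 : f zq.1 = a * f zq.1 + b * f zq.1 := by rw [← add_mul, hab, one_mul]
  nlinarith [mul_le_mul_of_nonneg_left h1 ha, mul_le_mul_of_nonneg_left h2 hb]

/-- **Subgradients of `f` are subgradients of the extension**: for `y' ∈ closedBall x₀ r` and
`q ∈ ∂_U f(y')`, `q` is a subgradient of `convexExtension f U x₀ r` at `y'` relative to the whole
space. [folklore] -/
theorem hasSubgradientWithinAt_convexExtension (hU : IsOpen U) (hf : ConvexOn ℝ U f) (hr : 0 ≤ r)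
    (hrR : r < R) (hRU : closedBall x₀ R ⊆ U) {y' q : E} (hy' : y' ∈ closedBall x₀ r)
    (hq : HasSubgradientWithinAt f U q y') :
    HasSubgradientWithinAt (convexExtension f U x₀ r) univ q y' := by
  intro z _
  rw [convexExtension_eq hU hf hr hrR hRU hy']
  exact le_csSup (bddAbove_minorants hU hf hrR hRU z) ⟨(y', q), ⟨hy', hq⟩, rfl⟩

end Extension

/-! ### Alexandrov's theorem for convex functions on open sets -/

section Local

variable [MeasurableSpace E] [BorelSpace E] {μ : Measure E} [μ.IsAddHaarMeasure]

/-- **Alexandrov's theorem on an open convex set.** Let `f` be convex on an open (convex) set `U`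
of a finite-dimensional real inner product space, `μ` an additive Haar measure. Then for a.e.
`y ∈ U` there are `p : E`, `B : E →L[ℝ] E` such that `f` has gradient `p` at `y`, the
subdifferential `∂_U f` is differentiable at `y` with derivative `B` (uniformly over subgradients at
nearby points), and `f (y + h) = f y + ⟪p, h⟫ + ½⟪B h, h⟫ + o(‖h‖²)`. (Localisation of
`ConvexOn.ae_hasGradientAt_taylor_two` through `convexExtension`.) Evans–Gariepy, Thm. 6.9;
Chruściel–Delay–Galloway–Howard 2001, Prop. 2.1 (convex case).
[cite: EvansGariepy1992, Thm. 6.9 (PDF p. 154)] -/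
theorem ConvexOn.ae_hasGradientAt_taylor_two_of_isOpen {f : E → ℝ} {U : Set E} (hU : IsOpen U)
    (hf : ConvexOn ℝ U f) :
    ∀ᵐ y ∂μ, y ∈ U → ∃ (p : E) (B : E →L[ℝ] E),
      HasGradientAt f p y ∧
      (∀ ε > 0, ∃ η > 0, ∀ y' q, ‖y' - y‖ < η → HasSubgradientWithinAt f U q y' →
        ‖q - p - B (y' - y)‖ ≤ ε * ‖y' - y‖) ∧
      (fun h ↦ f (y + h) - f y - ⟪p, h⟫ - ⟪B h, h⟫ / 2) =o[𝓝 0] fun h ↦ ‖h‖ ^ 2 := by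
  refine ae_mem_imp_of_forall_exists_mem_nhdsWithin (μ := μ) fun x hx ↦ ?_
  -- a ball `closedBall x R ⊆ U` and the extension from `closedBall x (R / 2)`
  obtain ⟨R₀, hR₀, hball⟩ := Metric.mem_nhds_iff.mp (hU.mem_nhds hx)
  set R : ℝ := R₀ / 2 with hR
  have hR0 : 0 < R := by positivity
  have hRU : closedBall x R ⊆ U := (closedBall_subset_ball (by linarith)).trans hball
  set r : ℝ := R / 2 with hr
  have hr0 : 0 < r := by positivity
  have hrR : r < R := by rw [hr]; linarith
  set F : E → ℝ := convexExtension f U x r with hF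
  have hFconv : ConvexOn ℝ univ F := convexOn_convexExtension hU hf hr0.le hrR hRU
  have hFeq : ∀ y ∈ closedBall x r, F y = f y := fun y hy ↦ convexExtension_eq hU hf hr0.le hrR hRU hy
  refine ⟨ball x r, mem_nhdsWithin_of_mem_nhds (ball_mem_nhds x hr0), ?_⟩
  filter_upwards [ConvexOn.ae_hasGradientAt_taylor_two (μ := μ) hFconv] with y hy hyx
  obtain ⟨p, B, hgrad, hsub, hlittle⟩ := hy
  -- `f = F` near `y`
  have hρ : 0 < r - dist y x := by rw [mem_ball] at hyx; linarith
  have hnear : ∀ y', ‖y' - y‖ < r - dist y x → y' ∈ closedBall x r := by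
    intro y' hy'
    rw [mem_closedBall]
    calc dist y' x ≤ dist y' y + dist y x := dist_triangle _ _ _
      _ ≤ (r - dist y x) + dist y x := by rw [dist_eq_norm]; linarith
      _ = r := by ring
  have hev : f =ᶠ[𝓝 y] F := by
    filter_upwards [Metric.ball_mem_nhds y hρ] with y' hy'
    rw [mem_ball, dist_eq_norm] at hy'
    exact (hFeq y' (hnear y' hy')).symm
  refine ⟨p, B, ?_, ?_, ?_⟩
  · exact HasFDerivAt.congr_of_eventuallyEq hgrad hev
  · intro ε hε
    obtain ⟨η, hη, hest⟩ := hsub ε hε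
    refine ⟨min η (r - dist y x), lt_min hη hρ, fun y' q hy' hq ↦ ?_⟩
    rw [lt_min_iff] at hy'
    exact hest y' q hy'.1
      (hasSubgradientWithinAt_convexExtension hU hf hr0.le hrR hRU (hnear y' hy'.2) hq)
  · refine hlittle.congr' ?_ EventuallyEq.rfl
    have h0 : ∀ᶠ h in 𝓝 (0 : E), ‖h‖ < r - dist y x := by
      filter_upwards [Metric.ball_mem_nhds (0 : E) hρ] with h hh
      rwa [mem_ball, dist_zero_right] at hh
    filter_upwards [h0] with h hh
    have h1 : F (y + h) = f (y + h) := hFeq _ (hnear _ (by rwa [add_sub_cancel_left]))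
    have h2 : F y = f y := hFeq _ (hnear _ (by simpa using hρ))
    rw [h1, h2]

end Local

/-! ### Second-order Taylor expansion of `C²` functions at a point -/

section Taylor

variable {F : Type*} [NormedAddCommGroup F] [NormedSpace ℝ F]

omit [InnerProductSpace ℝ E] [FiniteDimensional ℝ E] in
/-- **Second-order Taylor expansion at a point.** If `φ` is differentiable near `y` with derivative
`φ'`, and `φ'` is differentiable at `y` with derivative `φ''`, then
`φ (y + h) - φ y - φ' y h - ½ φ'' h h = o(‖h‖²)` as `h → 0` (mean value inequality along the
segment applied to `t ↦ φ (y + t h) - t φ' y h - (t²/2) φ'' h h`, whose derivative is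
`(φ'(y + t h) - φ' y - φ''(t h)) h = o(‖h‖) ‖h‖`). [folklore] -/
theorem taylor_two_isLittleO_of_hasFDerivAt {φ : F → ℝ} {φ' : F → F →L[ℝ] ℝ}
    {φ'' : F →L[ℝ] F →L[ℝ] ℝ} {y : F} (hφ : ∀ᶠ z in 𝓝 y, HasFDerivAt φ (φ' z) z)
    (hφ' : HasFDerivAt φ' φ'' y) :
    (fun h ↦ φ (y + h) - φ y - φ' y h - φ'' h h / 2) =o[𝓝 0] fun h ↦ ‖h‖ ^ 2 := by
  refine isLittleO_iff.mpr fun c hc ↦ ?_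
  -- a ball on which `φ` is differentiable and `φ'` is `c`-approximately linear
  have h1 : ∀ᶠ z in 𝓝 y, ‖φ' z - φ' y - φ'' (z - y)‖ ≤ c * ‖z - y‖ := by
    have := (hasFDerivAt_iff_isLittleO_nhds_zero.mp hφ').def hc
    rw [← map_add_left_nhds_zero y, eventually_map] at *
    -- rewrite `z = y + h`
    filter_upwards [this] with h hh
    simpa only [add_sub_cancel_left] using hh
  obtain ⟨ρ, hρ, hball⟩ := Metric.eventually_nhds_iff.mp (hφ.and h1)
  have hmem : ball (0 : F) ρ ∈ 𝓝 (0 : F) := ball_mem_nhds 0 hρ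
  filter_upwards [hmem] with h hh
  rw [mem_ball, dist_zero_right] at hh
  -- the auxiliary function of one variable
  set g : ℝ → ℝ := fun t ↦ φ (y + t • h) - t * (φ' y h) - t ^ 2 / 2 * (φ'' h h) with hg
  set g' : ℝ → ℝ := fun t ↦ (φ' (y + t • h) - φ' y - φ'' (t • h)) h with hg'
  have hderiv : ∀ t ∈ Icc (0 : ℝ) 1, HasDerivAt g (g' t) t := by
    intro t ht
    have hyt : dist (y + t • h) y < ρ := by
      rw [dist_eq_norm, add_sub_cancel_left, norm_smul, Real.norm_of_nonneg ht.1]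
      calc t * ‖h‖ ≤ 1 * ‖h‖ := by gcongr; exact ht.2
        _ = ‖h‖ := one_mul _
        _ < ρ := hh
    have hφt : HasFDerivAt φ (φ' (y + t • h)) (y + t • h) := (hball hyt).1
    have hline : HasDerivAt (fun s : ℝ ↦ y + s • h) h t := by
      simpa using ((hasDerivAt_id t).smul_const h).const_add y
    have hcomp : HasDerivAt (fun s : ℝ ↦ φ (y + s • h)) (φ' (y + t • h) h) t :=
      hφt.comp_hasDerivAt t hline
    have hlin : HasDerivAt (fun s : ℝ ↦ s * (φ' y h)) (φ' y h) t := by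
      simpa using (hasDerivAt_id t).mul_const (φ' y h)
    have hquad : HasDerivAt (fun s : ℝ ↦ s ^ 2 / 2 * (φ'' h h)) (t * (φ'' h h)) t := by
      have := ((hasDerivAt_pow 2 t).div_const 2).mul_const (φ'' h h)
      simpa [pow_one] using this
    have hall := (hcomp.sub hlin).sub hquad
    refine hall.congr_deriv ?_
    show φ' (y + t • h) h - φ' y h - t * (φ'' h h) = (φ' (y + t • h) - φ' y - φ'' (t • h)) h
    rw [map_smul]
    rfl
  have hbound : ∀ t ∈ Ico (0 : ℝ) 1, ‖g' t‖ ≤ c * ‖h‖ ^ 2 := by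
    intro t ht
    have hyt : dist (y + t • h) y < ρ := by
      rw [dist_eq_norm, add_sub_cancel_left, norm_smul, Real.norm_of_nonneg ht.1]
      calc t * ‖h‖ ≤ 1 * ‖h‖ := by gcongr; exact ht.2.le
        _ = ‖h‖ := one_mul _
        _ < ρ := hh
    have h2 := (hball hyt).2
    rw [add_sub_cancel_left] at h2
    calc ‖g' t‖ ≤ ‖φ' (y + t • h) - φ' y - φ'' (t • h)‖ * ‖h‖ :=
          (φ' (y + t • h) - φ' y - φ'' (t • h)).le_opNorm h
      _ ≤ c * ‖t • h‖ * ‖h‖ := by gcongr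
      _ ≤ c * ‖h‖ * ‖h‖ := by
          gcongr
          rw [norm_smul, Real.norm_of_nonneg ht.1]
          calc t * ‖h‖ ≤ 1 * ‖h‖ := by gcongr; exact ht.2.le
            _ = ‖h‖ := one_mul _
      _ = c * ‖h‖ ^ 2 := by ring
  have hMV := norm_image_sub_le_of_norm_deriv_le_segment' (fun t ht ↦ (hderiv t ht).hasDerivWithinAt)
    hbound 1 (right_mem_Icc.mpr zero_le_one)
  have hg1 : g 1 - g 0 = φ (y + h) - φ y - φ' y h - φ'' h h / 2 := by
    simp only [hg, one_smul, one_mul, one_pow, zero_smul, add_zero, zero_mul, sub_zero, ne_eq,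
      OfNat.ofNat_ne_zero, not_false_eq_true, zero_pow, zero_div]
    ring
  rw [hg1, sub_zero, mul_one] at hMV
  rw [Real.norm_of_nonneg (by positivity : (0 : ℝ) ≤ ‖h‖ ^ 2)]
  exact hMV

end Taylor

/-! ### Semi-convex functions and CDGH Prop. 2.1 -/

section Semiconvex

/-- A function `f` is **semi-convex on the open set `O`** (Chruściel–Delay–Galloway–Howard 2001,
§2: "a continuous function `f : 𝒪 → ℝ` is called semi-convex iff each point `p` has a convex
neighborhood `𝒰` in `𝒪` so that there exists a `C²` function `φ : 𝒰 → ℝ` such that `f + φ` is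
convex in `𝒰`"): every point of `O` has an open convex neighbourhood `U ⊆ O` and a function `φ`,
`C²` on `U`, with `f + φ` convex on `U`. (Continuity of `f` on `O` then follows and is not made
part of the definition.) [cite: ChruscielEtAl2001, §2 (definition of semi-convexity)] -/
def SemiconvexOn (O : Set E) (f : E → ℝ) : Prop :=
  ∀ x ∈ O, ∃ U : Set E, IsOpen U ∧ Convex ℝ U ∧ x ∈ U ∧ U ⊆ O ∧
    ∃ φ : E → ℝ, ContDiffOn ℝ 2 φ U ∧ ConvexOn ℝ U (f + φ)

omit [FiniteDimensional ℝ E] in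
/-- A convex function on an open convex set is semi-convex there (`φ = 0`). [folklore] -/
theorem ConvexOn.semiconvexOn {O : Set E} {f : E → ℝ} (hO : IsOpen O) (hf : ConvexOn ℝ O f) :
    SemiconvexOn O f := fun x hx ↦
  ⟨O, hO, hf.1, hx, Subset.rfl, 0, contDiffOn_const, by simpa using hf⟩

/-- The vector `B h` representing the continuous bilinear form `φ''` through the inner product:
`⟪bilinToCLM φ'' h, v⟫ = φ'' h v`. [folklore] -/
def bilinToCLM (Q : E →L[ℝ] E →L[ℝ] ℝ) : E →L[ℝ] E :=
  haveI : CompleteSpace E := FiniteDimensional.complete ℝ E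
  LinearMap.toContinuousLinearMap
    { toFun := fun h ↦ (toDual ℝ E).symm (Q h)
      map_add' := fun h₁ h₂ ↦ by rw [map_add, map_add]
      map_smul' := fun c h ↦ by
        rw [map_smul, LinearIsometryEquiv.map_smulₛₗ, RingHom.id_apply, starRingEnd_apply,
          star_trivial] }

/-- Defining property of `bilinToCLM`. [folklore] -/
theorem inner_bilinToCLM (Q : E →L[ℝ] E →L[ℝ] ℝ) (h v : E) : ⟪bilinToCLM Q h, v⟫ = Q h v := by
  haveI : CompleteSpace E := FiniteDimensional.complete ℝ E
  show ⟪(toDual ℝ E).symm (Q h), v⟫ = Q h v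
  rw [toDual_symm_apply]

variable [MeasurableSpace E] [BorelSpace E] {μ : Measure E} [μ.IsAddHaarMeasure]

/-- **Alexandrov's theorem for semi-convex functions** (Chruściel–Delay–Galloway–Howard 2001,
Prop. 2.1, after Fleming–Soner; Evans–Gariepy Thm. 6.9 for convex `f`): if `f` is semi-convex on
the open set `O` of a finite-dimensional real inner product space, then for a.e. `y ∈ O` (with
respect to any additive Haar measure) `f` is differentiable at `y`, with gradient `p`, and has a
second-order expansion `f (y + h) = f y + ⟪p, h⟫ + ½⟪B h, h⟫ + o(‖h‖²)` for some
`B : E →L[ℝ] E` — CDGH's "Alexandrov points", eqs. (2.2)–(2.3). Proof: locally `f = g - φ` with `g`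
convex on an open convex `U` (Alexandrov's theorem on `U`,
`ConvexOn.ae_hasGradientAt_taylor_two_of_isOpen`) and `φ` of class `C²` (Taylor,
`taylor_two_isLittleO_of_hasFDerivAt`); countably many such `U` cover `O`.
[cite: ChruscielEtAl2001, Prop. 2.1] -/
theorem SemiconvexOn.ae_hasGradientAt_taylor_two {O : Set E} {f : E → ℝ} (hf : SemiconvexOn O f) :
    ∀ᵐ y ∂μ, y ∈ O → ∃ (p : E) (B : E →L[ℝ] E), HasGradientAt f p y ∧
      (fun h ↦ f (y + h) - f y - ⟪p, h⟫ - ⟪B h, h⟫ / 2) =o[𝓝 0] fun h ↦ ‖h‖ ^ 2 := by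
  haveI : CompleteSpace E := FiniteDimensional.complete ℝ E
  refine ae_mem_imp_of_forall_exists_mem_nhdsWithin (μ := μ) fun x hx ↦ ?_
  obtain ⟨U, hUo, -, hxU, hUO, φ, hφ, hg⟩ := hf x hx
  refine ⟨U, mem_nhdsWithin_of_mem_nhds (hUo.mem_nhds hxU), ?_⟩
  filter_upwards [ConvexOn.ae_hasGradientAt_taylor_two_of_isOpen (μ := μ) hUo hg] with y hy hyU
  obtain ⟨pg, Bg, hgrad, -, hlittle⟩ := hy hyU
  -- `φ` is `C²` at `y`
  have hφy : ContDiffAt ℝ 2 φ y := hφ.contDiffAt (hUo.mem_nhds hyU)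
  have hφy' : ContDiffAt ℝ ((1 : ℕ) + 1 : ℕ) φ y := by
    simpa only [Nat.reduceAdd, Nat.cast_ofNat] using hφy
  obtain ⟨φ', ⟨u, hu, hderiv⟩, hC1⟩ := contDiffAt_succ_iff_hasFDerivAt.mp hφy'
  have hev : ∀ᶠ z in 𝓝 y, HasFDerivAt φ (φ' z) z := Filter.eventually_of_mem hu hderiv
  have hφ'' : HasFDerivAt φ' (fderiv ℝ φ' y) y :=
    (hC1.differentiableAt (by simp)).hasFDerivAt
  set φ'' : E →L[ℝ] E →L[ℝ] ℝ := fderiv ℝ φ' y with hφ''def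
  have hTaylor := taylor_two_isLittleO_of_hasFDerivAt hev hφ''
  -- the data for `f = (f + φ) - φ`
  set p : E := pg - (toDual ℝ E).symm (φ' y) with hp
  set B : E →L[ℝ] E := Bg - bilinToCLM φ'' with hB
  refine ⟨p, B, ?_, ?_⟩
  · -- gradient
    have h1 : HasFDerivAt (f + φ) (toDual ℝ E pg) y := hgrad
    have h2 : HasFDerivAt φ (φ' y) y := hev.self_of_nhds
    have h3 := h1.sub h2
    have h4 : (f + φ) - φ = f := by funext z; simp
    rw [h4] at h3
    show HasFDerivAt f (toDual ℝ E p) y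
    have h5 : toDual ℝ E p = toDual ℝ E pg - φ' y := by
      rw [hp, map_sub, LinearIsometryEquiv.apply_symm_apply]
    rw [h5]
    exact h3
  · -- second-order expansion
    have hdiff := hlittle.sub hTaylor
    refine hdiff.congr' (Eventually.of_forall fun h ↦ ?_) EventuallyEq.rfl
    have e1 : ⟪p, h⟫ = ⟪pg, h⟫ - φ' y h := by
      rw [hp, inner_sub_left, toDual_symm_apply]
    have e2 : ⟪B h, h⟫ = ⟪Bg h, h⟫ - φ'' h h := by
      rw [hB, show (Bg - bilinToCLM φ'') h = Bg h - bilinToCLM φ'' h from rfl, inner_sub_left,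
        inner_bilinToCLM]
    simp only [Pi.add_apply, e1, e2]
    ring

end Semiconvex

end Literature.Analysis.Convex

end
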